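import Summits.QuantumFields.BalabanUV.Beta.FP.CompositeMinimiserJunction
import Literature.MathematicalPhysics.QuantumFieldTheory.Balaban1983to89.Beta.KKTFluctuationKernel

/-!
# `BalabanUV.Beta.FP.CompositeCovariancePeriodise` — road «FP» for binder row D1, row **IR-5′ (a) «THE ff JUNCTION»**, an2's side on `ℤ^{d+1}`
# (owner ruling R-FP-35 (f): «your NEXT: the ff junction `Gam^{per} = ½N²·𝒞`»): THE PERIODISED FLUCTUATION-COVARIANCE COLUMN of an2's typed
# `U = 1` KKT system — `Γ^per_{(l,x′)} := Σ_{t∈ℤ^{d+1}} Γ_N(·; (l, x′ − (NM)•t))` (`KKTFluctuationKernel.Gam`, source summed over the fine period lattice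
# `pshift (fine N M) ℤ^{d+1}`) — together with its periodised constraint and gauge multipliers, and THE FOUR COLUMN IDENTITIES SURVIVING THE
# PERIODISATION: (Q) zero block averages, (G) block-constant gauge quantity, (M) zero block sums of the gauge multiplier, (EL) the Euler–Lagrange
# row with BOTH multipliers and the PERIODIC unit force `𝟙[κ = l ∧ x ≡ x′ mod NM]`

NOT IN PRINT; OUR BOOKKEEPING.  HONEST FRAMING (cell contract, verbatim): «discharging `BetaPertH` makes Bałaban's UV stability UNCONDITIONAL — a real
constructive-QFT result; it is NOT the continuum limit and NOT the Clay problem.»  HONEST DEPENDENCY (verbatim): «continuum YM on T⁴ ⇐ BetaPertH ∧ nine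
spine estimates (0/9 proved); BetaPertH ⇐ (D1) ∧ (D4) ∧ CAP+tail; G-an2-4 gates asym, D1 and NE2/3/4.»  THIS MODULE proves NO estimate and instantiates NO
wall binder: three [our object] periodisations (absolutely convergent period sums, `KKTFluctuationKernel.decay_wΓ`∕`decay_wΓφ`∕`decay_wΓμ` at FIXED `N`)
and the transport of an2's column identities `Gam_Q`∕`Gam_G`∕`GamM_M`∕`Gam_EL` through them, term by term (the finite stencils commute with the sums:
`KernelSpecInstance.hasSum_*`).  The torus side (the junction with b05's `𝒞 = 𝒫G` of (1.107)) is `FP/CompositeCovarianceJunction`.  Cites nothing;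
0 sorry.  NOT the ff dictionary by itself, NOT IR-5′'s letters, NOT hbook, NOT D1, NOT BetaPertH, NOT continuum, NOT Clay.  Pattern: gan24-leaf-18's
`GAN24/TorusPeriodise` (the minimiser column `Hper`); here the source is a FINE bond, so the period sum runs over the SOURCE and no shift lemma is needed
(an2's identities hold for every source bond).

ABSOLUTE RULE (cell charter, verbatim): «No internally-minted statement may enter as a cited fact. Every hypothesis is either kernel-proved in this package or
a verbatim quotation of a PUBLISHED theorem with page reference. The manuscript(s) under audit are NOT citable for their own disputed steps — they are the
thing under adjudication; programme-internal (2001/route/tribunal) claims are never citable.»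

CONTENT (every `d`, `N ≥ 1`, torus `M : Fin (d+1) → ℕ`).  §1 the translates of an2's kernels under a fine-period shift of the SOURCE (`Gam_sub_pshift`,
`GamΦ_sub_pshift`, `GamM_sub_pshift`: the residue `proj N x′` is unchanged, the block index moves by `pshift M t`), summability of the three period sums.
§2 [our object] `Gper`, `GΦper`, `GMper` + `hasSum_*` + periodicity (`periodic_Gper` fine, `periodic_GΦper` coarse, `periodic_GMper` fine).  §3 the identities:
**`contourSum_Gper = 0`**, **`gauge_Gper`** (block-constancy), **`blockSum_GMper = 0`**, **`curvAdj_curv_Gper`** (EL with the periodic unit force).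
Provenance: D1 formalisation swarm, unit `b2b-balaban-beta-d1-formalise-leaf-05` gen 15, 2026-08-21; owner GO R-FP-35 (f).
-/

open Finset
open scoped BigOperators

namespace Summit.QuantumFields.BalabanUV.Beta.FP.CompositeCovariancePeriodise

open Literature.Probability.LatticeModels (Torus.proj)
open Literature.MathematicalPhysics.QuantumFieldTheory
open Literature.MathematicalPhysics.QuantumFieldTheory.Balaban1983to89
open Literature.MathematicalPhysics.QuantumFieldTheory.Balaban1983to89.Beta
open AffineAveraging (Site Form0 Form1 dz curv curvAdj codiff₁ box toSite blockSum contourSum)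
open AffineReproduction (contourSumAdj)
open LatticeForm (quo proj_add_zsmul)
open BlochFibreUniqueness (quo_add_zsmul)
open B5Prop11Plancherel (fine)
open B12Sec2to5 (l1 Decay510)
open KernelSpecInstance (hasSum_dz hasSum_codiff₁ hasSum_curv hasSum_curvAdj hasSum_contourSum hasSum_contourSumAdj)
open KKTFluctuationKernel (Gam GamΦ GamM wΓ wΓφ wΓμ Gam_EL Gam_G GamM_M Gam_Q decay_wΓ decay_wΓφ decay_wΓμ)
open Summit.QuantumFields.BalabanUV.Beta.GAN24.TorusAvatar (toTor Periodic toTor_sub)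
open Summit.QuantumFields.BalabanUV.Beta.GAN24.TorusPeriodise (pshift pshift_add pshift_unitVec pshift_fine pshift_injective summable_pshift
  tsum_shift_index toTor_pshift)

noncomputable section

variable {d : ℕ} (N : ℕ) [NeZero N] (M : Fin (d + 1) → ℕ)

/-! ## §1 Fine-period shifts of the source: residue unchanged, block index translated; summability -/

omit [NeZero N] in
/-- A fine-period shift of the source leaves the residue `proj N` unchanged. -/
theorem proj_sub_pshift (x' t : Site (d + 1)) : Torus.proj N (x' - pshift (fine N M) t) = Torus.proj N x' := by
  rw [pshift_fine, sub_eq_add_neg, ← smul_neg]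
  exact proj_add_zsmul x' _

/-- … and moves the block index by the coarse period: `quo N (x′ − (NM)•t) = quo N x′ − M•t`. -/
theorem quo_sub_pshift (x' t : Site (d + 1)) : quo N (x' - pshift (fine N M) t) = quo N x' - pshift M t := by
  rw [pshift_fine, sub_eq_add_neg, ← smul_neg, quo_add_zsmul, sub_eq_add_neg]

/-- an2's covariance kernel with the source shifted by a fine period, in terms of the block-`0` kernel `wΓ`. -/
theorem Gam_sub_pshift (κ : Fin (d + 1)) (x : Site (d + 1)) (l : Fin (d + 1)) (x' t : Site (d + 1)) :
    Gam (N := N) κ x l (x' - pshift (fine N M) t) = wΓ (N := N) l (Torus.proj N x') κ ((x - (N : ℤ) • quo N x') + pshift (fine N M) t) := by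
  simp only [Gam]
  rw [proj_sub_pshift, quo_sub_pshift, smul_sub, pshift_fine]
  congr 1
  abel

/-- The constraint multiplier with the source shifted by a fine period. -/
theorem GamΦ_sub_pshift (κ : Fin (d + 1)) (q : Site (d + 1)) (l : Fin (d + 1)) (x' t : Site (d + 1)) :
    GamΦ (N := N) κ q l (x' - pshift (fine N M) t) = wΓφ (N := N) l (Torus.proj N x') κ ((q - quo N x') + pshift M t) := by
  simp only [GamΦ, proj_sub_pshift, quo_sub_pshift]
  congr 1
  abel

/-- The gauge multiplier with the source shifted by a fine period. -/
theorem GamM_sub_pshift (z : Site (d + 1)) (l : Fin (d + 1)) (x' t : Site (d + 1)) :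
    GamM (N := N) z l (x' - pshift (fine N M) t) = wΓμ (N := N) l (Torus.proj N x') ((z - (N : ℤ) • quo N x') + pshift (fine N M) t) := by
  simp only [GamM]
  rw [proj_sub_pshift, quo_sub_pshift, smul_sub, pshift_fine]
  congr 1
  abel

variable [∀ ν, NeZero (M ν)]

/-- Summability of the source-periodisation of the covariance column (exponential decay of `wΓ` at fixed `N`). -/
theorem summable_Gam_pshift (κ : Fin (d + 1)) (x : Site (d + 1)) (l : Fin (d + 1)) (x' : Site (d + 1)) :
    Summable (fun t : Site (d + 1) => Gam (N := N) κ x l (x' - pshift (fine N M) t)) := by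
  obtain ⟨δ, C, hδ, _, h⟩ := decay_wΓ (N := N) (d := d)
  simp only [Gam_sub_pshift]
  exact summable_pshift hδ (h l _ κ) (fine N M) _

/-- Summability of the source-periodisation of the constraint multiplier. -/
theorem summable_GamΦ_pshift (κ : Fin (d + 1)) (q : Site (d + 1)) (l : Fin (d + 1)) (x' : Site (d + 1)) :
    Summable (fun t : Site (d + 1) => GamΦ (N := N) κ q l (x' - pshift (fine N M) t)) := by
  obtain ⟨δ, C, hδ, _, h⟩ := decay_wΓφ (N := N) (d := d)
  simp only [GamΦ_sub_pshift]
  exact summable_pshift hδ (h l _ κ) M _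

/-- Summability of the source-periodisation of the gauge multiplier. -/
theorem summable_GamM_pshift (z : Site (d + 1)) (l : Fin (d + 1)) (x' : Site (d + 1)) :
    Summable (fun t : Site (d + 1) => GamM (N := N) z l (x' - pshift (fine N M) t)) := by
  obtain ⟨δ, C, hδ, _, h⟩ := decay_wΓμ (N := N) (d := d)
  simp only [GamM_sub_pshift]
  exact summable_pshift hδ (h l _) (fine N M) _

/-! ## §2 The periodised column and its multipliers -/

/-- [our object] **THE PERIODISED FLUCTUATION-COVARIANCE COLUMN** `Γ^per_{(l,x′)} := Σ_t Γ_N(·; (l, x′ − (NM)•t))` (source summed over the fine period lattice). -/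
def Gper (l : Fin (d + 1)) (x' : Site (d + 1)) : Form1 (d + 1) ℝ :=
  fun κ x => ∑' t : Site (d + 1), Gam (N := N) κ x l (x' - pshift (fine N M) t)

/-- [our object] Its periodised CONSTRAINT multiplier (a coarse 1-form). -/
def GΦper (l : Fin (d + 1)) (x' : Site (d + 1)) : Form1 (d + 1) ℝ :=
  fun κ q => ∑' t : Site (d + 1), GamΦ (N := N) κ q l (x' - pshift (fine N M) t)

/-- [our object] Its periodised GAUGE multiplier (a fine 0-form). -/
def GMper (l : Fin (d + 1)) (x' : Site (d + 1)) : Form0 (d + 1) ℝ :=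
  fun z => ∑' t : Site (d + 1), GamM (N := N) z l (x' - pshift (fine N M) t)

/-- `HasSum` form of `Gper`. -/
theorem hasSum_Gper (l : Fin (d + 1)) (x' : Site (d + 1)) (κ : Fin (d + 1)) (x : Site (d + 1)) :
    HasSum (fun t : Site (d + 1) => Gam (N := N) κ x l (x' - pshift (fine N M) t)) (Gper N M l x' κ x) :=
  (summable_Gam_pshift N M κ x l x').hasSum

/-- `HasSum` form of `GΦper`. -/
theorem hasSum_GΦper (l : Fin (d + 1)) (x' : Site (d + 1)) (κ : Fin (d + 1)) (q : Site (d + 1)) :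
    HasSum (fun t : Site (d + 1) => GamΦ (N := N) κ q l (x' - pshift (fine N M) t)) (GΦper N M l x' κ q) :=
  (summable_GamΦ_pshift N M κ q l x').hasSum

/-- `HasSum` form of `GMper`. -/
theorem hasSum_GMper (l : Fin (d + 1)) (x' : Site (d + 1)) (z : Site (d + 1)) :
    HasSum (fun t : Site (d + 1) => GamM (N := N) z l (x' - pshift (fine N M) t)) (GMper N M l x' z) :=
  (summable_GamM_pshift N M z l x').hasSum

omit [∀ ν, NeZero (M ν)] in
/-- The periodised column is periodic under the FINE period lattice `fine N M` (block translation covariance of `Γ_N` + re-indexing). -/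
theorem periodic_Gper (l : Fin (d + 1)) (x' : Site (d + 1)) (κ : Fin (d + 1)) : Periodic (fine N M) (Gper N M l x' κ) := by
  intro x ν
  simp only [Gper]
  have e : ∀ t : Site (d + 1), Gam (N := N) κ (x + ((fine N M ν : ℕ) : ℤ) • AffineAveraging.unitVec ν) l (x' - pshift (fine N M) t)
      = Gam (N := N) κ x l (x' - pshift (fine N M) (t + AffineAveraging.unitVec ν)) := by
    intro t
    rw [Gam_sub_pshift, Gam_sub_pshift, pshift_add, pshift_unitVec]
    congr 1
    abel
  simp_rw [e]
  exact tsum_shift_index (fun t => Gam (N := N) κ x l (x' - pshift (fine N M) t)) (AffineAveraging.unitVec ν)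

omit [∀ ν, NeZero (M ν)] in
/-- The periodised constraint multiplier is periodic under the COARSE period lattice `M`. -/
theorem periodic_GΦper (l : Fin (d + 1)) (x' : Site (d + 1)) (κ : Fin (d + 1)) : Periodic M (GΦper N M l x' κ) := by
  intro q ν
  simp only [GΦper]
  have e : ∀ t : Site (d + 1), GamΦ (N := N) κ (q + ((M ν : ℕ) : ℤ) • AffineAveraging.unitVec ν) l (x' - pshift (fine N M) t)
      = GamΦ (N := N) κ q l (x' - pshift (fine N M) (t + AffineAveraging.unitVec ν)) := by
    intro t
    rw [GamΦ_sub_pshift, GamΦ_sub_pshift, pshift_add, pshift_unitVec]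
    congr 1
    abel
  simp_rw [e]
  exact tsum_shift_index (fun t => GamΦ (N := N) κ q l (x' - pshift (fine N M) t)) (AffineAveraging.unitVec ν)

omit [∀ ν, NeZero (M ν)] in
/-- The periodised gauge multiplier is periodic under the FINE period lattice. -/
theorem periodic_GMper (l : Fin (d + 1)) (x' : Site (d + 1)) : Periodic (fine N M) (GMper N M l x') := by
  intro z ν
  simp only [GMper]
  have e : ∀ t : Site (d + 1), GamM (N := N) (z + ((fine N M ν : ℕ) : ℤ) • AffineAveraging.unitVec ν) l (x' - pshift (fine N M) t)
      = GamM (N := N) z l (x' - pshift (fine N M) (t + AffineAveraging.unitVec ν)) := by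
    intro t
    rw [GamM_sub_pshift, GamM_sub_pshift, pshift_add, pshift_unitVec]
    congr 1
    abel
  simp_rw [e]
  exact tsum_shift_index (fun t => GamM (N := N) z l (x' - pshift (fine N M) t)) (AffineAveraging.unitVec ν)

/-! ## §3 The four column identities survive the periodisation -/

/-- **(Q)^per — ZERO BLOCK AVERAGES**: the periodised covariance column is a fluctuation field, `𝒬_N Γ^per = 0` (an2's `Gam_Q` term by term). -/
theorem contourSum_Gper (l : Fin (d + 1)) (x' : Site (d + 1)) (κ : Fin (d + 1)) (y : Site (d + 1)) :
    contourSum N (Gper N M l x') κ y = 0 := by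
  have h1 : HasSum (fun t : Site (d + 1) => contourSum N (fun κ z => Gam (N := N) κ z l (x' - pshift (fine N M) t)) κ y)
      (contourSum N (Gper N M l x') κ y) :=
    hasSum_contourSum (fun κ' z => hasSum_Gper N M l x' κ' z) κ y
  simp only [Gam_Q] at h1
  exact h1.unique hasSum_zero

/-- **(G)^per — THE GAUGE QUANTITY IS BLOCK-CONSTANT**: `δdδ(Γ^per_{(l,x′)})(N•y + b) = δdδ(Γ^per_{(l,x′)})(N•y)` for `b ∈ box` (an2's `Gam_G` term by term). -/
theorem gauge_Gper (l : Fin (d + 1)) (x' y : Site (d + 1)) {b : Fin (d + 1) → ℕ} (hb : b ∈ box (d + 1) N) :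
    codiff₁ (dz (codiff₁ (Gper N M l x'))) ((N : ℤ) • y + toSite b) = codiff₁ (dz (codiff₁ (Gper N M l x'))) ((N : ℤ) • y) := by
  have h1 : ∀ x, HasSum (fun t : Site (d + 1) => codiff₁ (fun κ z => Gam (N := N) κ z l (x' - pshift (fine N M) t)) x)
      (codiff₁ (Gper N M l x') x) := fun x => hasSum_codiff₁ (fun κ z => hasSum_Gper N M l x' κ z) x
  have h2 : ∀ κ x, HasSum (fun t : Site (d + 1) => dz (codiff₁ (fun κ z => Gam (N := N) κ z l (x' - pshift (fine N M) t))) κ x)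
      (dz (codiff₁ (Gper N M l x')) κ x) := fun κ x => hasSum_dz h1 κ x
  have h3 : ∀ x, HasSum (fun t : Site (d + 1) => codiff₁ (dz (codiff₁ (fun κ z => Gam (N := N) κ z l (x' - pshift (fine N M) t)))) x)
      (codiff₁ (dz (codiff₁ (Gper N M l x'))) x) := fun x => hasSum_codiff₁ h2 x
  have e : (fun t : Site (d + 1) => codiff₁ (dz (codiff₁ (fun κ z => Gam (N := N) κ z l (x' - pshift (fine N M) t)))) ((N : ℤ) • y + toSite b))
      = fun t => codiff₁ (dz (codiff₁ (fun κ z => Gam (N := N) κ z l (x' - pshift (fine N M) t)))) ((N : ℤ) • y) := by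
    funext t; exact Gam_G l _ y b hb
  have h4 := h3 ((N : ℤ) • y + toSite b)
  rw [e] at h4
  exact h4.unique (h3 _)

/-- **(M)^per — ZERO BLOCK SUMS OF THE GAUGE MULTIPLIER** (an2's `GamM_M` term by term). -/
theorem blockSum_GMper (l : Fin (d + 1)) (x' y : Site (d + 1)) : blockSum N (GMper N M l x') y = 0 := by
  have h1 : HasSum (fun t : Site (d + 1) => blockSum N (fun z => GamM (N := N) z l (x' - pshift (fine N M) t)) y) (blockSum N (GMper N M l x') y) := by
    simp only [blockSum]
    exact hasSum_sum fun b _ => hasSum_GMper N M l x' _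
  simp only [GamM_M] at h1
  exact h1.unique hasSum_zero

/-- The periodic unit force: `Σ_t 𝟙[μ = l ∧ x = x′ − (NM)•t] = 𝟙[μ = l ∧ x ≡ x′ mod NM]` (exactly one period translate of the source hits a congruent bond). -/
theorem hasSum_delta_pshift (l μ : Fin (d + 1)) (x' x : Site (d + 1)) :
    HasSum (fun t : Site (d + 1) => if μ = l ∧ x = x' - pshift (fine N M) t then (1 : ℝ) else 0)
      (if μ = l ∧ toTor (fine N M) x = toTor (fine N M) x' then 1 else 0) := by
  by_cases h : μ = l ∧ toTor (fine N M) x = toTor (fine N M) x'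
  · have hd : ∀ ν, ((fine N M ν : ℕ) : ℤ) ∣ x' ν - x ν := by
      intro ν
      have hν := congr_fun h.2 ν
      simp only [toTor] at hν
      exact (ZMod.intCast_eq_intCast_iff_dvd_sub _ _ _).1 hν
    choose t₀ ht₀ using hd
    have hx : x' - pshift (fine N M) t₀ = x := by
      funext ν; simp only [Pi.sub_apply, pshift]; have := ht₀ ν; linarith
    have e : (fun t : Site (d + 1) => if μ = l ∧ x = x' - pshift (fine N M) t then (1 : ℝ) else 0) = fun t => if t = t₀ then 1 else 0 := by
      funext t
      by_cases ht : t = t₀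
      · subst ht; rw [if_pos ⟨h.1, hx.symm⟩, if_pos rfl]
      · rw [if_neg ht, if_neg]
        rintro ⟨-, hy⟩
        apply ht
        apply pshift_injective (fine N M)
        have : x' - pshift (fine N M) t = x' - pshift (fine N M) t₀ := by rw [← hy, hx]
        simpa using this
    rw [e, if_pos h]
    exact hasSum_ite_eq t₀ 1
  · rw [if_neg h]
    have e : (fun t : Site (d + 1) => if μ = l ∧ x = x' - pshift (fine N M) t then (1 : ℝ) else 0) = fun _ => 0 := by
      funext t
      rw [if_neg]
      rintro ⟨hμ, hy⟩
      apply h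
      refine ⟨hμ, ?_⟩
      rw [hy, toTor_sub, toTor_pshift, sub_zero]
    rw [e]
    exact hasSum_zero

/-- **(EL)^per — THE EULER–LAGRANGE ROW SURVIVES PERIODISATION, WITH THE PERIODIC UNIT FORCE**:
`d*dΓ^per_{(l,x′)} = 𝒬ᵀ_N Φ^per + dδd M^per + 𝟙[κ = l ∧ x ≡ x′ mod NM]` (an2's `Gam_EL` for every translated source, summed). -/
theorem curvAdj_curv_Gper (l : Fin (d + 1)) (x' : Site (d + 1)) (μ : Fin (d + 1)) (x : Site (d + 1)) :
    curvAdj (curv (Gper N M l x')) μ x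
      = contourSumAdj N (GΦper N M l x') μ x + dz (codiff₁ (dz (GMper N M l x'))) μ x
        + (if μ = l ∧ toTor (fine N M) x = toTor (fine N M) x' then 1 else 0) := by
  have hL : HasSum (fun t : Site (d + 1) => curvAdj (curv (fun κ z => Gam (N := N) κ z l (x' - pshift (fine N M) t))) μ x)
      (curvAdj (curv (Gper N M l x')) μ x) :=
    hasSum_curvAdj (fun κ l' z => hasSum_curv (fun κ' z' => hasSum_Gper N M l x' κ' z') κ l' z) μ x
  have hΦ : HasSum (fun t : Site (d + 1) => contourSumAdj N (fun κ q => GamΦ (N := N) κ q l (x' - pshift (fine N M) t)) μ x)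
      (contourSumAdj N (GΦper N M l x') μ x) :=
    hasSum_contourSumAdj (fun κ q => hasSum_GΦper N M l x' κ q) μ x
  have hM1 : ∀ z, HasSum (fun t : Site (d + 1) => GamM (N := N) z l (x' - pshift (fine N M) t)) (GMper N M l x' z) :=
    fun z => hasSum_GMper N M l x' z
  have hM : HasSum (fun t : Site (d + 1) => dz (codiff₁ (dz (fun z => GamM (N := N) z l (x' - pshift (fine N M) t)))) μ x)
      (dz (codiff₁ (dz (GMper N M l x'))) μ x) :=
    hasSum_dz (fun z => hasSum_codiff₁ (fun κ z' => hasSum_dz hM1 κ z') z) μ x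
  have hδ := hasSum_delta_pshift N M l μ x' x
  have e : (fun t : Site (d + 1) => curvAdj (curv (fun κ z => Gam (N := N) κ z l (x' - pshift (fine N M) t))) μ x)
      = fun t => contourSumAdj N (fun κ q => GamΦ (N := N) κ q l (x' - pshift (fine N M) t)) μ x
          + dz (codiff₁ (dz (fun z => GamM (N := N) z l (x' - pshift (fine N M) t)))) μ x
          + (if μ = l ∧ x = x' - pshift (fine N M) t then (1 : ℝ) else 0) := by
    funext t; exact Gam_EL l _ μ x
  rw [e] at hL
  exact hL.unique ((hΦ.add hM).add hδ)

end

end Summit.QuantumFields.BalabanUV.Beta.FP.CompositeCovariancePeriodise
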